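import Literature.Computability.Complexity.PromiseBPPAmplification
import Literature.Computability.Complexity.PromiseBPPClosureProofs
import Literature.Computability.Complexity.SamplingChernoff
import Literature.Computability.Complexity.CoinCounting
import HarnessLib

/-!
# Exponential error reduction and padding for promise-BPP (Arora–Barak 2009, Thm. 7.10)

Trunk toolkit for `PromiseCookReductions.lean` (closure of promise-BPP under Cook reductions,
Goldreich 2006, §1.2, remark after Def. 3), continuing `PromiseBPPAmplification.lean`. That file
builds, for a witness `L' ∈ P` with coin polynomial `p` and a polynomial `r`, the majority-vote
language `PromiseAmp.ampLang L' p r ∈ P` over `K = 18 r + 19` independent runs and bounds its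
error on the promise by `1/(r + 1)` with Chebyshev's inequality. Here the SAME machine is analysed
with the Chernoff–Hoeffding bound (`card_lowerDeviation_le_exp`, `SamplingChernoff.lean`), which is
the printed argument (Arora–Barak 2009, Thm. 7.10: "run `M(x)` `k` times … output the majority
answer … by the Chernoff bound the error is `2^{-Ω(k)}`"): `K = 18 r + 19` votes of individual
success probability `≥ 2/3 = 1/2 + 1/6` fail to have a good strict majority with probability
`≤ exp(-2 K (1/6)²) = exp(-K/18) ≤ exp(-(r + 1))`.

* `card_majority_fail_le_exp` — majority vote, exponential form (counting version);
* `PromiseAmp.uniformProb_ampLang_compl_le_exp`, `PromiseAmp.uniformProb_ampLang_le_exp` — the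
  two one-sided error bounds `≤ exp(-(r(|x|) + 1))` for `ampLang`;
* `PromiseProblem.exists_amplifier_exp_of_mem_PromiseBPP'` — for `Q ∈ PromiseBPP'` and every
  polynomial `r`: a witness `L'' ∈ P`, coins `p''`, two-sided error `≤ exp(-(r(|x|) + 1))` on the
  promise, verdict depending on the first `p''(|x|)` coins only;
* `PromiseProblem.disjoint_of_mem_PromiseBPP'` — a problem in promise-BPP has disjoint YES/NO sets;
* `PromiseProblem.padded Q` — the cylinder `{⟨y, t⟩ | y ∈ Q}` (padding an instance with an
  arbitrary tag `t`, so that the error of an amplified decider can be driven by `|⟨y, t⟩| ≥ |t|`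
  rather than by `|y|`; Arora–Barak 2009, §2.6 padding), `padded_polyTimeReducible` (it
  Karp-reduces to `Q` by the first projection) and `padded_mem_PromiseBPP'` (Goldreich 2006 §1.2:
  promise-BPP is closed under Karp reductions, `mem_PromiseBPP'_of_polyTimeReducible_holds`).

## References

* S. Arora, B. Barak, *Computational Complexity: A Modern Approach*, CUP 2009, §7.4.1 and
  Thm. 7.10 (error reduction by majority vote and the Chernoff bound), §2.6 (padding)
  [AroraBarak2009].
* O. Goldreich, *On promise problems: a survey*, LNCS 3895 (2006) 254–290, §1.2 Def. 2 (BPP as a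
  class of promise problems: the constant `2/3` is immaterial) and Def. 3 [GoldreichPromise2006].
* W. Hoeffding, *Probability inequalities for sums of bounded random variables*, JASA 58 (1963),
  Thm. 1.
-/

noncomputable section

namespace Literature.Computability.Complexity

open _root_.Computability Polynomial Finset Real

open scoped Classical

/-! ### Majority vote, exponential form -/

/-- **Majority vote with the Chernoff–Hoeffding bound.** If the good outcomes have density
`≥ 1/2 + 1/6` then among the outcome sequences of `m ≥ 1` independent uniform trials those WITHOUT
a strict majority of good trials number at most `exp(-m/18) · |α|^m` (lower deviation `≥ m/6`,
`exp(-2 m η²)` with `η = 1/6`). [cite: AroraBarak2009, Thm. 7.10 (proof, Chernoff bound)] -/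
theorem card_majority_fail_le_exp {α : Type*} [Fintype α] [Nonempty α]
    (good : α → Prop) [DecidablePred good] {m : ℕ} (hm : 0 < m)
    (hgood : (1 / 2 + 1 / 6 : ℝ) * Fintype.card α ≤ (univ.filter good).card) :
    ((univ.filter fun ω : Fin m → α => 2 * (univ.filter fun i => good (ω i)).card ≤ m).card : ℝ)
      ≤ exp (-((m : ℝ) / 18)) * Fintype.card (Fin m → α) := by
  have h := card_lowerDeviation_le_exp good hm (η := 1 / 6) (by norm_num)
  have hα : (0 : ℝ) < Fintype.card α := by exact_mod_cast Fintype.card_pos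
  have hp : (1 / 2 + 1 / 6 : ℝ) ≤ (univ.filter good).card / Fintype.card α := by
    rw [le_div_iff₀ hα]; exact hgood
  have hsub : (univ.filter fun ω : Fin m → α => 2 * (univ.filter fun i => good (ω i)).card ≤ m) ⊆
      (univ.filter fun ω : Fin m → α => (m : ℝ) * (1 / 6) ≤
        m * ((univ.filter good).card / Fintype.card α) -
          ((univ.filter fun i => good (ω i)).card : ℝ)) := by
    intro ω hω
    simp only [mem_filter, mem_univ, true_and] at hω ⊢
    have hω' : (2 : ℝ) * ((univ.filter fun i => good (ω i)).card : ℝ) ≤ m := by exact_mod_cast hω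
    have hm0 : (0 : ℝ) ≤ m := Nat.cast_nonneg m
    nlinarith
  have hexp : exp (-2 * (m : ℝ) * (1 / 6) ^ 2) = exp (-((m : ℝ) / 18)) := by
    congr 1; ring
  calc ((univ.filter fun ω : Fin m → α => 2 * (univ.filter fun i => good (ω i)).card ≤ m).card : ℝ)
      ≤ ((univ.filter fun ω : Fin m → α => (m : ℝ) * (1 / 6) ≤
          m * ((univ.filter good).card / Fintype.card α) -
            ((univ.filter fun i => good (ω i)).card : ℝ)).card : ℝ) := by
        exact_mod_cast card_le_card hsub
    _ ≤ _ := by rw [← hexp]; exact h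

namespace PromiseAmp

variable (L' : Language Bool) (p r : Polynomial ℕ)

/-- `exp(-K/18) ≤ exp(-(R + 1))` for `K = 18 R + 19` votes. [folklore] -/
theorem exp_votes_le (R : ℕ) : exp (-(((18 * R + 19 : ℕ) : ℝ) / 18)) ≤ exp (-((R : ℝ) + 1)) := by
  rw [exp_le_exp]
  push_cast
  have hR : (0 : ℝ) ≤ R := Nat.cast_nonneg R
  rw [neg_le_neg_iff, le_div_iff₀ (by norm_num : (0 : ℝ) < 18)]
  linarith

variable {L'}

/-- **A wrong majority is exponentially rare (YES side).** If each block accepts with probability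
`≥ 2/3`, the counter of `ampLang L' p r` fails to be exhausted with probability
`≤ exp(-(r(|x|) + 1))`. [cite: AroraBarak2009, Thm. 7.10 (Chernoff bound)] -/
theorem uniformProb_ampLang_compl_le_exp (x : List Bool)
    (hx : 2 / 3 ≤ uniformProb (p.eval x.length) {v | boolPair x v ∈ L'}) :
    uniformProb ((coins p r).eval x.length) {y | boolPair x y ∉ ampLang L' p r} ≤
      exp (-(((r.eval x.length : ℕ) : ℝ) + 1)) := by
  have hKN : (votes r).eval x.length + 1 ≤ (coins p r).eval x.length := by rw [coins_eval, votes_eval]; omega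
  have hKℓN : (votes r).eval x.length * p.eval x.length ≤ (coins p r).eval x.length := by
    rw [coins_eval, votes_eval]; nlinarith
  have hKpos : 0 < (votes r).eval x.length := by rw [votes_eval]; omega
  have hKexp : exp (-(((votes r).eval x.length : ℕ) : ℝ) / 18) ≤ exp (-(((r.eval x.length : ℕ) : ℝ) + 1)) := by
    rw [votes_eval, neg_div]; exact exp_votes_le (r.eval x.length)
  generalize hK : (votes r).eval x.length = K at hKN hKℓN hKpos hKexp
  generalize hℓ : p.eval x.length = ℓ at hKℓN hx
  generalize hN : (coins p r).eval x.length = N at hKN hKℓN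
  -- the event on strings of length `N`
  have h1 : uniformProb N {y | boolPair x y ∉ ampLang L' p r} =
      uniformProb N {y | y.take (K * ℓ) ∈ {y' | 2 * yesCount L' p x y' K ≤ K}} := by
    refine uniformProb_congr fun y hy => ?_
    simp only [Set.mem_setOf_eq]
    rw [boolPair_mem_ampLang_iff_le _ _ _ _ (by rw [hy, hK]; exact hKN), hK,
      yesCount_take _ _ _ (by rw [hℓ])]
    omega
  rw [h1, uniformProb_take_of_le hKℓN, uniformProb_eq_card_fun]
  simp only [Set.mem_setOf_eq]
  -- count over blocks
  have hf : ∀ f : Fin (K * ℓ) → Bool, yesCount L' p x (List.ofFn f) K =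
      (univ.filter fun i : Fin K => boolPair x (List.ofFn (blockEquiv K ℓ f i)) ∈ L').card := by
    intro f
    have := yesCount_ofFn (L' := L') p x (K := K) (hℓ ▸ f)
    subst hℓ
    exact this
  have hcard : (univ.filter fun f : Fin (K * ℓ) → Bool => 2 * yesCount L' p x (List.ofFn f) K ≤ K).card =
      (univ.filter fun ω : Fin K → (Fin ℓ → Bool) =>
        2 * (univ.filter fun i => boolPair x (List.ofFn (ω i)) ∈ L').card ≤ K).card := by
    refine card_equiv (blockEquiv K ℓ) fun f => ?_
    simp only [mem_filter, mem_univ, true_and]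
    rw [hf]
  have hmaj := card_majority_fail_le_exp (α := Fin ℓ → Bool) (fun v => boolPair x (List.ofFn v) ∈ L')
    (m := K) hKpos (good_card_of_uniformProb hx)
  rw [Fintype.card_fun, Fintype.card_fin, card_fun_fin_bool, ← pow_mul, mul_comm ℓ K, ← hcard] at hmaj
  rw [div_le_iff₀ (by positivity)]
  refine le_trans (by exact_mod_cast hmaj) ?_
  have hKexp' : exp (-((K : ℝ) / 18)) ≤ exp (-(((r.eval x.length : ℕ) : ℝ) + 1)) := by
    rw [← neg_div]; exact_mod_cast hKexp
  push_cast
  exact mul_le_mul_of_nonneg_right hKexp' (by positivity)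

/-- **A wrong majority is exponentially rare (NO side).** If each block rejects with probability
`≥ 2/3`, the counter of `ampLang L' p r` is exhausted with probability `≤ exp(-(r(|x|) + 1))`.
[cite: AroraBarak2009, Thm. 7.10 (Chernoff bound)] -/
theorem uniformProb_ampLang_le_exp (x : List Bool)
    (hx : 2 / 3 ≤ uniformProb (p.eval x.length) {v | boolPair x v ∉ L'}) :
    uniformProb ((coins p r).eval x.length) {y | boolPair x y ∈ ampLang L' p r} ≤
      exp (-(((r.eval x.length : ℕ) : ℝ) + 1)) := by
  have hKN : (votes r).eval x.length + 1 ≤ (coins p r).eval x.length := by rw [coins_eval, votes_eval]; omega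
  have hKℓN : (votes r).eval x.length * p.eval x.length ≤ (coins p r).eval x.length := by
    rw [coins_eval, votes_eval]; nlinarith
  have hKpos : 0 < (votes r).eval x.length := by rw [votes_eval]; omega
  have hKexp : exp (-(((votes r).eval x.length : ℕ) : ℝ) / 18) ≤ exp (-(((r.eval x.length : ℕ) : ℝ) + 1)) := by
    rw [votes_eval, neg_div]; exact exp_votes_le (r.eval x.length)
  generalize hK : (votes r).eval x.length = K at hKN hKℓN hKpos hKexp
  generalize hℓ : p.eval x.length = ℓ at hKℓN hx
  generalize hN : (coins p r).eval x.length = N at hKN hKℓN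
  have h1 : uniformProb N {y | boolPair x y ∈ ampLang L' p r} =
      uniformProb N {y | y.take (K * ℓ) ∈ {y' | K + 1 ≤ 2 * yesCount L' p x y' K}} := by
    refine uniformProb_congr fun y hy => ?_
    simp only [Set.mem_setOf_eq]
    rw [boolPair_mem_ampLang_iff_le _ _ _ _ (by rw [hy, hK]; exact hKN), hK,
      yesCount_take _ _ _ (by rw [hℓ])]
  rw [h1, uniformProb_take_of_le hKℓN, uniformProb_eq_card_fun]
  simp only [Set.mem_setOf_eq]
  have hf : ∀ f : Fin (K * ℓ) → Bool, yesCount L' p x (List.ofFn f) K =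
      (univ.filter fun i : Fin K => boolPair x (List.ofFn (blockEquiv K ℓ f i)) ∈ L').card := by
    intro f
    have := yesCount_ofFn (L' := L') p x (K := K) (hℓ ▸ f)
    subst hℓ
    exact this
  -- the event implies a non-majority of rejecting blocks
  have hcard : (univ.filter fun f : Fin (K * ℓ) → Bool => K + 1 ≤ 2 * yesCount L' p x (List.ofFn f) K).card ≤
      (univ.filter fun ω : Fin K → (Fin ℓ → Bool) =>
        2 * (univ.filter fun i => boolPair x (List.ofFn (ω i)) ∉ L').card ≤ K).card := by
    rw [← card_map (blockEquiv K ℓ).toEmbedding]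
    refine card_le_card fun ω hω => ?_
    simp only [mem_map_equiv, mem_filter, mem_univ, true_and] at hω ⊢
    rw [hf, Equiv.apply_symm_apply] at hω
    have hsum : (univ.filter fun i : Fin K => boolPair x (List.ofFn (ω i)) ∈ L').card +
        (univ.filter fun i : Fin K => boolPair x (List.ofFn (ω i)) ∉ L').card = K := by
      rw [card_filter_add_card_filter_not, card_univ, Fintype.card_fin]
    omega
  have hmaj := card_majority_fail_le_exp (α := Fin ℓ → Bool) (fun v => boolPair x (List.ofFn v) ∉ L')
    (m := K) hKpos (by simpa only [Set.mem_setOf_eq] using good_card_of_uniformProb hx)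
  rw [Fintype.card_fun, Fintype.card_fin, card_fun_fin_bool, ← pow_mul, mul_comm ℓ K] at hmaj
  rw [div_le_iff₀ (by positivity)]
  have hKexp' : exp (-((K : ℝ) / 18)) ≤ exp (-(((r.eval x.length : ℕ) : ℝ) + 1)) := by
    rw [← neg_div]; exact_mod_cast hKexp
  push_cast at hmaj ⊢
  have hcard' : ((univ.filter fun f : Fin (K * ℓ) → Bool => K + 1 ≤ 2 * yesCount L' p x (List.ofFn f) K).card : ℝ) ≤
      (univ.filter fun ω : Fin K → (Fin ℓ → Bool) =>
        2 * (univ.filter fun i => boolPair x (List.ofFn (ω i)) ∉ L').card ≤ K).card := by exact_mod_cast hcard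
  exact hcard'.trans (hmaj.trans (mul_le_mul_of_nonneg_right hKexp' (by positivity)))

end PromiseAmp

/-! ### The exponential amplification theorem -/

open PromiseAmp in
/-- **Error reduction for promise-BPP, exponential form** (Arora–Barak 2009, Thm. 7.10, for the
promise class of Goldreich 2006, Def. 2): for `Q ∈ PromiseBPP'` and every polynomial `r` there is a
witness language `L'' ∈ P` with a coin polynomial `p''` deciding `Q` with two-sided error
`≤ exp(-(r(|x|) + 1))` on the promise, whose verdict depends only on the first `p''(|x|)` coins.
[cite: AroraBarak2009, Thm. 7.10; GoldreichPromise2006 §1.2 Def. 2] -/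
theorem PromiseProblem.exists_amplifier_exp_of_mem_PromiseBPP' {Q : PromiseProblem} (hQ : Q ∈ PromiseBPP')
    (r : Polynomial ℕ) :
    ∃ L'' ∈ Classes.P, ∃ p'' : Polynomial ℕ,
      (∀ x ∈ Q.yes, uniformProb (p''.eval x.length) {y | boolPair x y ∉ L''} ≤ exp (-(((r.eval x.length : ℕ) : ℝ) + 1))) ∧
      (∀ x ∈ Q.no, uniformProb (p''.eval x.length) {y | boolPair x y ∈ L''} ≤ exp (-(((r.eval x.length : ℕ) : ℝ) + 1))) ∧
      (∀ x y : List Bool, ∀ N, p''.eval x.length ≤ N → (boolPair x (y.take N) ∈ L'' ↔ boolPair x y ∈ L'')) := by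
  obtain ⟨L', hL', p, hyes, hno⟩ := hQ
  exact ⟨ampLang L' p r, ampLang_mem_P p r hL', coins p r,
    fun x hx => uniformProb_ampLang_compl_le_exp p r x (hyes x hx),
    fun x hx => uniformProb_ampLang_le_exp p r x (hno x hx),
    fun x y N hN => boolPair_mem_ampLang_iff_take p r x y hN⟩

/-! ### Disjointness and padding -/

namespace PromiseProblem

/-- **A problem in promise-BPP has disjoint YES and NO sets**: on a common instance the acceptance
and rejection probabilities would both be `≥ 2/3`, but they sum to `1`. [cite: GoldreichPromise2006, §1.2 Def. 2 (with Def. 1: the promise partitions into YES and NO)] -/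
theorem disjoint_of_mem_PromiseBPP' {Q : PromiseProblem} (hQ : Q ∈ PromiseBPP') : Q.Disjoint := by
  obtain ⟨L', -, p, hyes, hno⟩ := hQ
  refine Set.disjoint_left.2 fun x hxy hxn => ?_
  have h1 := hyes x hxy
  have h2 := hno x hxn
  have hc : {y : List Bool | boolPair x y ∉ L'} = {y : List Bool | boolPair x y ∈ L'}ᶜ := rfl
  rw [hc, uniformProb_compl] at h2
  linarith

/-- **The padded problem** `Q.padded = {⟨y, t⟩ | y ∈ Q}`: an instance of `Q` tagged with an
arbitrary string `t` (read through the pair decoder, `fstP`). Padding lets the error of an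
amplified decider be governed by the length of the tag (Arora–Barak 2009, §2.6, padding
technique); YES/NO membership is that of the first component. [cite: AroraBarak2009, §2.6 (padding)] -/
def padded (Q : PromiseProblem) : PromiseProblem :=
  ⟨{z | fstP z ∈ Q.yes}, {z | fstP z ∈ Q.no}⟩

/-- A pair is a YES instance of `Q.padded` iff its first component is a YES instance of `Q`. [folklore] -/
@[simp] theorem boolPair_mem_padded_yes (Q : PromiseProblem) (y t : List Bool) :
    boolPair y t ∈ Q.padded.yes ↔ y ∈ Q.yes := by
  show fstP (boolPair y t) ∈ Q.yes ↔ _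
  rw [fstP_boolPair]

/-- A pair is a NO instance of `Q.padded` iff its first component is a NO instance of `Q`. [folklore] -/
@[simp] theorem boolPair_mem_padded_no (Q : PromiseProblem) (y t : List Bool) :
    boolPair y t ∈ Q.padded.no ↔ y ∈ Q.no := by
  show fstP (boolPair y t) ∈ Q.no ↔ _
  rw [fstP_boolPair]

/-- **`Q.padded` Karp-reduces to `Q`** by the first projection `fstP ∈ FP`. [cite: GoldreichPromise2006, §1.2 Def. 3 (Karp reductions among promise problems)] -/
theorem padded_polyTimeReducible (Q : PromiseProblem) : Q.padded.PolyTimeReducible Q :=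
  ⟨fstP, fstP_mem_FP, fun _ hz => hz, fun _ hz => hz⟩

/-- **`Q ∈ PromiseBPP' ⟹ Q.padded ∈ PromiseBPP'`** (promise-BPP is closed under Karp reductions,
Goldreich 2006 §1.2, `mem_PromiseBPP'_of_polyTimeReducible_holds`). [cite: GoldreichPromise2006, §1.2, remark after Def. 3 (p. 258)] -/
theorem padded_mem_PromiseBPP' {Q : PromiseProblem} (hQ : Q ∈ PromiseBPP') : Q.padded ∈ PromiseBPP' :=
  mem_PromiseBPP'_of_polyTimeReducible_holds _ _ Q.padded_polyTimeReducible hQ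

end PromiseProblem

end Literature.Computability.Complexity

end
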